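import Summits.Ventures.Crystal3D.Theorems.StickyWulffConstantCoaxialWallLawLayeredLocal
import Literature.Geometry.DiscreteGeometry.LayerPinning
import HarnessLib

/-!
# The off-site budget of `stub_coaxialTwoSlabAdhesion`, III: pinning — a ball between two locally complete layers is on-site

HONEST FRAMING. Part of the venture `Summits/Ventures/Crystal3D` (cell `crystal3d-full`), helper
`--supports` the crux `CoaxialWallLaw` (stmt-Ventures-19481, `route-Ventures-StickyWulffConstant`),
REGISTERED line `WallLedgerF` (planner cf-p1 gen 16), open stub `stub_coaxialTwoSlabAdhesion`.
RUNG CREDIT ONLY; F-C1 not moved.  Planner programme (xxix) (F-pin): the off-site budget law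
(`…CoaxialWallLawOffSite.coaxialTwoSlabAdhesion_offSite`) charges an arbitrary filling only through the
off-site contacts of its on-site riser balls; this file localises the OFF-SITE balls themselves, by
transporting the literature's layer pinning (`Literature.Geometry.DiscreteGeometry.layer_pinning_hollow_local`,
Hales DSP §1.3) to the moved co-axial frame `(L, s)` and identifying the pinned hollows with sites:

* **`site_of_pinned`** — `X` `1`-separated, `q ∈ X`; in the frame `(L, s)` let `q` lie strictly between the
  site-lattice layers `k` and `k + 2`, and let the (at most three) sites of letter `ℓ₀` in layer `k` and of
  letter `ℓ₂` in layer `k + 2` whose feet are within planar squared distance `1/3` of `q`'s foot all be balls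
  of `X`.  Then `q` IS a site: `q = L (i u₁ + j u₂ + c w + (k+1) ν) + s` with `c ∈ {ℓ₀ + 1, ℓ₀ + 2}`.
  Contrapositive (the localisation of (F-off)): an OFF-SITE ball has, for every such `k` and every pair of
  letters, a VACANT covering site in layer `k` or in layer `k + 2` — it sits over or under a holed layer
  (riser core, channel, foreign plate edge).

WHAT THIS IS NOT: no count of off-site balls; nothing about which pinned sites are occupied; F-C1 not moved.
-/

noncomputable section

namespace Summit.Ventures.Crystal3D.Theorems

open Summit.Ventures.Crystal3D Finset
open Literature.MathematicalPhysics.StatisticalMechanics (triangularVec₁ triangularVec₂ barlowOffset layerNormal)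
open Literature.Geometry.DiscreteGeometry (layer_pinning_hollow_local)
open scoped InnerProductSpace

/-- Coordinates `0` and `1` of a site vector: `(i + j/2 + c/2, (√3/2) j + (√3/6) c)`. -/
theorem site_apply_zero_one (i j c k : ℤ) :
    ((i : ℝ) • triangularVec₁ (1 : ℝ) + (j : ℝ) • triangularVec₂ (1 : ℝ) + (c : ℝ) • barlowOffset (1 : ℝ) +
      (k : ℝ) • layerNormal (Real.sqrt (2 / 3)) : EuclideanSpace ℝ (Fin 3)) 0 = i + j / 2 + c / 2 ∧
    ((i : ℝ) • triangularVec₁ (1 : ℝ) + (j : ℝ) • triangularVec₂ (1 : ℝ) + (c : ℝ) • barlowOffset (1 : ℝ) +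
      (k : ℝ) • layerNormal (Real.sqrt (2 / 3)) : EuclideanSpace ℝ (Fin 3)) 1 =
      Real.sqrt 3 / 2 * j + Real.sqrt 3 / 6 * c := by
  constructor
  · simp [triangularVec₁, triangularVec₂, barlowOffset, layerNormal]; ring
  · simp [triangularVec₁, triangularVec₂, barlowOffset, layerNormal]; ring

/-- **Pinning: a ball strictly between two locally complete site-lattice layers is on-site.**  See the module
docstring.  The frame coordinates of `q` are those of `L.symm (q − s)`. -/
theorem site_of_pinned
    (L : EuclideanSpace ℝ (Fin 3) ≃ₗᵢ[ℝ] EuclideanSpace ℝ (Fin 3)) (s : EuclideanSpace ℝ (Fin 3))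
    (X : Finset (EuclideanSpace ℝ (Fin 3)))
    (hX : ∀ p ∈ X, ∀ q ∈ X, p ≠ q → 1 ≤ dist p q)
    {q : EuclideanSpace ℝ (Fin 3)} (hq : q ∈ X) (k ℓ₀ ℓ₂ : ℤ)
    (hlo : (k : ℝ) * Real.sqrt (2 / 3) < (L.symm (q - s)) 2)
    (hhi : (L.symm (q - s)) 2 < ((k : ℝ) + 2) * Real.sqrt (2 / 3))
    (hlow : ∀ a b : ℤ,
      ((L.symm (q - s)) 0 - (ℓ₀ : ℝ) / 2 - (a + b / 2)) ^ 2 +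
        ((L.symm (q - s)) 1 - Real.sqrt 3 / 6 * ℓ₀ - b * (Real.sqrt 3 / 2)) ^ 2 ≤ 1 / 3 →
      L ((a : ℝ) • triangularVec₁ (1 : ℝ) + (b : ℝ) • triangularVec₂ (1 : ℝ) + (ℓ₀ : ℝ) • barlowOffset (1 : ℝ) +
        (k : ℝ) • layerNormal (Real.sqrt (2 / 3))) + s ∈ X)
    (hup : ∀ a b : ℤ,
      ((L.symm (q - s)) 0 - (ℓ₂ : ℝ) / 2 - (a + b / 2)) ^ 2 +
        ((L.symm (q - s)) 1 - Real.sqrt 3 / 6 * ℓ₂ - b * (Real.sqrt 3 / 2)) ^ 2 ≤ 1 / 3 →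
      L ((a : ℝ) • triangularVec₁ (1 : ℝ) + (b : ℝ) • triangularVec₂ (1 : ℝ) + (ℓ₂ : ℝ) • barlowOffset (1 : ℝ) +
        (((k + 2 : ℤ)) : ℝ) • layerNormal (Real.sqrt (2 / 3))) + s ∈ X) :
    ∃ i j c : ℤ, (c = ℓ₀ + 1 ∨ c = ℓ₀ + 2) ∧
      q = L ((i : ℝ) • triangularVec₁ (1 : ℝ) + (j : ℝ) • triangularVec₂ (1 : ℝ) + (c : ℝ) • barlowOffset (1 : ℝ) +
        (((k + 1 : ℤ)) : ℝ) • layerNormal (Real.sqrt (2 / 3))) + s := by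
  set qt : EuclideanSpace ℝ (Fin 3) := L.symm (q - s) with hqt
  have hqL : q = L qt + s := by rw [hqt, LinearIsometryEquiv.apply_symm_apply, sub_add_cancel]
  -- distances from `q` to sites, in the frame
  have hdist : ∀ p : EuclideanSpace ℝ (Fin 3), L p + s ∈ X → L p + s ≠ q → 1 ≤ ‖qt - p‖ := by
    intro p hp hne
    have h := hX q hq (L p + s) hp hne.symm
    rw [dist_eq_norm, hqL, show L qt + s - (L p + s) = L qt - L p by abel, ← map_sub,
      LinearIsometryEquiv.norm_map] at h
    exact h
  -- the two local layer families
  have hlow' : ∀ a b : ℤ, (qt 0 - (ℓ₀ : ℝ) / 2 - (a + b / 2)) ^ 2 +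
      (qt 1 - Real.sqrt 3 / 6 * ℓ₀ - b * (Real.sqrt 3 / 2)) ^ 2 ≤ 1 / 3 →
      ∃ p : EuclideanSpace ℝ (Fin 3), p 0 = (ℓ₀ : ℝ) / 2 + a + b / 2 ∧
        p 1 = Real.sqrt 3 / 6 * ℓ₀ + b * (Real.sqrt 3 / 2) ∧ p 2 = (k : ℝ) * Real.sqrt (2 / 3) ∧ 1 ≤ ‖qt - p‖ := by
    intro a b hab
    set p : EuclideanSpace ℝ (Fin 3) := (a : ℝ) • triangularVec₁ (1 : ℝ) + (b : ℝ) • triangularVec₂ (1 : ℝ) +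
      (ℓ₀ : ℝ) • barlowOffset (1 : ℝ) + (k : ℝ) • layerNormal (Real.sqrt (2 / 3)) with hp
    obtain ⟨hp0, hp1⟩ := site_apply_zero_one a b ℓ₀ k
    have hp2 : p 2 = k * Real.sqrt (2 / 3) := site_apply_two a b ℓ₀ k
    refine ⟨p, by rw [hp0]; ring, by rw [hp1]; ring, hp2, hdist p (hlow a b hab) ?_⟩
    intro hpe
    have : qt = p := by
      have := congrArg (fun x => L.symm (x - s)) hpe
      simpa [hqt] using this.symm
    rw [this, hp2] at hlo
    exact lt_irrefl _ hlo
  have hup' : ∀ a b : ℤ, (qt 0 - (ℓ₂ : ℝ) / 2 - (a + b / 2)) ^ 2 +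
      (qt 1 - Real.sqrt 3 / 6 * ℓ₂ - b * (Real.sqrt 3 / 2)) ^ 2 ≤ 1 / 3 →
      ∃ p : EuclideanSpace ℝ (Fin 3), p 0 = (ℓ₂ : ℝ) / 2 + a + b / 2 ∧
        p 1 = Real.sqrt 3 / 6 * ℓ₂ + b * (Real.sqrt 3 / 2) ∧ p 2 = ((k : ℝ) + 2) * Real.sqrt (2 / 3) ∧
        1 ≤ ‖qt - p‖ := by
    intro a b hab
    set p : EuclideanSpace ℝ (Fin 3) := (a : ℝ) • triangularVec₁ (1 : ℝ) + (b : ℝ) • triangularVec₂ (1 : ℝ) +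
      (ℓ₂ : ℝ) • barlowOffset (1 : ℝ) + (((k + 2 : ℤ)) : ℝ) • layerNormal (Real.sqrt (2 / 3)) with hp
    obtain ⟨hp0, hp1⟩ := site_apply_zero_one a b ℓ₂ (k + 2)
    have hp2 : p 2 = ((k + 2 : ℤ) : ℝ) * Real.sqrt (2 / 3) := site_apply_two a b ℓ₂ (k + 2)
    refine ⟨p, by rw [hp0]; ring, by rw [hp1]; ring, by rw [hp2]; push_cast; ring, hdist p (hup a b hab) ?_⟩
    intro hpe
    have : qt = p := by
      have := congrArg (fun x => L.symm (x - s)) hpe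
      simpa [hqt] using this.symm
    rw [this, hp2] at hhi
    push_cast at hhi
    exact lt_irrefl _ hhi
  -- pinning
  obtain ⟨hz, a, b, hab⟩ := layer_pinning_hollow_local qt ((ℓ₀ : ℝ) / 2) (Real.sqrt 3 / 6 * ℓ₀)
    ((k : ℝ) * Real.sqrt (2 / 3)) ((ℓ₂ : ℝ) / 2) (Real.sqrt 3 / 6 * ℓ₂) (((k : ℝ) + 2) * Real.sqrt (2 / 3))
    hlo hhi (by ring) hlow' hup'
  -- the hollow is a site of letter `ℓ₀ + 1` or `ℓ₀ + 2` in layer `k + 1`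
  have hext : ∀ c : ℤ, qt 0 = a + b / 2 + (c : ℝ) / 2 → qt 1 = Real.sqrt 3 / 2 * b + Real.sqrt 3 / 6 * c →
      qt = (a : ℝ) • triangularVec₁ (1 : ℝ) + (b : ℝ) • triangularVec₂ (1 : ℝ) + (c : ℝ) • barlowOffset (1 : ℝ) +
        (((k + 1 : ℤ)) : ℝ) • layerNormal (Real.sqrt (2 / 3)) := by
    intro c h0 h1
    obtain ⟨hp0, hp1⟩ := site_apply_zero_one a b c (k + 1)
    have hp2 := site_apply_two a b c (k + 1)
    have h2 : qt 2 = ((a : ℝ) • triangularVec₁ (1 : ℝ) + (b : ℝ) • triangularVec₂ (1 : ℝ) +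
        (c : ℝ) • barlowOffset (1 : ℝ) + (((k + 1 : ℤ)) : ℝ) • layerNormal (Real.sqrt (2 / 3)) :
        EuclideanSpace ℝ (Fin 3)) 2 := by
      rw [hp2, hz]; push_cast; ring
    ext t
    fin_cases t
    · exact h0.trans hp0.symm
    · exact h1.trans hp1.symm
    · exact h2
  rcases hab with ⟨h0, h1⟩ | ⟨h0, h1⟩
  · refine ⟨a, b, ℓ₀ + 1, Or.inl rfl, ?_⟩
    rw [hqL, hext (ℓ₀ + 1) (by rw [h0]; push_cast; ring) (by rw [h1]; push_cast; ring)]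
  · refine ⟨a, b, ℓ₀ + 2, Or.inr rfl, ?_⟩
    rw [hqL, hext (ℓ₀ + 2) (by rw [h0]; push_cast; ring) (by rw [h1]; push_cast; ring)]

end Summit.Ventures.Crystal3D.Theorems

end
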